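import Mathlib.Analysis.Calculus.BumpFunction.FiniteDimension
import Mathlib.Analysis.Calculus.BumpFunction.InnerProduct
import Mathlib.Analysis.Calculus.ContDiff.Operations
import Mathlib.Topology.Algebra.Support

/-!
# `SignConeOscillatory` (crux stmt-RiemannHypothesis-16302) — negative lemma §A′, the plateau comb

Generic bookkeeping for the REAL witness of
`Theorems/SignConeOscillatory/Negative/WithoutPDOriginDominating.lean`: a central smooth plateau bump `b₀`
(Mathlib's `ContDiffBump (0 : ℝ)`, `= 1` on `[-rIn, rIn]`, supported in `(-rOut, rOut)`, values in `[0, 1]`)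
MINUS finitely many symmetric pairs of translated plateau bumps `bᵢ(· - cᵢ) + bᵢ(· + cᵢ)`:

`f u = b₀ u - ∑ i, (bᵢ (u - cᵢ) + bᵢ (u + cᵢ))`.

Under the separation hypotheses "the central support ends before every pair support begins"
(`b₀.rOut + (b i).rOut ≤ c i`) and "pair supports are pairwise disjoint"
(`(b i).rOut + (b j).rOut ≤ |c i - c j|`), at most one bump is nonzero at any point, so `f` is smooth, even,
compactly supported, `|f| ≤ 1 = f 0`, `f = 1` on the central plateau, `f = -1` on the pair plateaus, `f = 0` off
the supports, `0 ≤ f ≤ 1` near the centre and `-1 ≤ f ≤ 0` away from it.  No definitions: every lemma takes the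
defining equation `hf : f = fun u => …` as a hypothesis.
-/

noncomputable section

-- `Summit.RiemannHypothesis.RiemannHypothesis.…` repeats a namespace component by design (D-0017 layout).
set_option linter.dupNamespace false

open scoped BigOperators
open Set

namespace Summit.RiemannHypothesis.RiemannHypothesis.Theorems.SignConeOscillatory.Negative

section Comb

variable {k : ℕ} {b₀ : ContDiffBump (0 : ℝ)} {b : Fin k → ContDiffBump (0 : ℝ)} {c : Fin k → ℝ} {f : ℝ → ℝ}

/-- A bump centred at `0` vanishes at `x` as soon as `rOut ≤ |x|`. -/
theorem bump_eq_zero_of_le_abs (β : ContDiffBump (0 : ℝ)) {x : ℝ} (hx : β.rOut ≤ |x|) : β x = 0 :=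
  β.zero_of_le_dist (by rwa [Real.dist_eq, sub_zero])

/-- A bump centred at `0` equals `1` at `x` as soon as `|x| ≤ rIn`. -/
theorem bump_eq_one_of_abs_le (β : ContDiffBump (0 : ℝ)) {x : ℝ} (hx : |x| ≤ β.rIn) : β x = 1 :=
  β.one_of_mem_closedBall (by rwa [Metric.mem_closedBall, Real.dist_eq, sub_zero])

/-- If a bump centred at `0` is nonzero at `x` then `|x| < rOut`. -/
theorem abs_lt_of_bump_ne_zero (β : ContDiffBump (0 : ℝ)) {x : ℝ} (hx : β x ≠ 0) : |x| < β.rOut := by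
  by_contra h
  exact hx (bump_eq_zero_of_le_abs β (not_lt.1 h))

/-- The comb is smooth. -/
theorem comb_contDiff (hf : f = fun u => b₀ u - ∑ i, (b i (u - c i) + b i (u + c i))) {n : ℕ∞} :
    ContDiff ℝ n f := by
  rw [hf]
  refine b₀.contDiff.sub (ContDiff.sum fun i _ => ?_)
  exact ((b i).contDiff.comp (contDiff_id.sub contDiff_const)).add
    ((b i).contDiff.comp (contDiff_id.add contDiff_const))

/-- The comb is even (each bump is even). -/
theorem comb_neg (hf : f = fun u => b₀ u - ∑ i, (b i (u - c i) + b i (u + c i))) (u : ℝ) :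
    f (-u) = f u := by
  rw [hf]
  simp only
  rw [b₀.neg]
  congr 1
  refine Finset.sum_congr rfl fun i _ => ?_
  rw [show -u - c i = -(u + c i) by ring, show -u + c i = -(u - c i) by ring, (b i).neg, (b i).neg, add_comm]

/-- Off all supports the comb vanishes. -/
theorem comb_eq_zero (hf : f = fun u => b₀ u - ∑ i, (b i (u - c i) + b i (u + c i))) {u : ℝ}
    (hu0 : b₀.rOut ≤ |u|) (hu : ∀ i, (b i).rOut ≤ |u - c i| ∧ (b i).rOut ≤ |u + c i|) : f u = 0 := by
  rw [hf]
  simp only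
  rw [bump_eq_zero_of_le_abs b₀ hu0, Finset.sum_eq_zero fun i _ => ?_, sub_zero]
  rw [bump_eq_zero_of_le_abs (b i) (hu i).1, bump_eq_zero_of_le_abs (b i) (hu i).2, add_zero]

/-- Off all supports on the right (`u ≥ 0`, pair centres `c i ≥ rOut`): the comb vanishes. -/
theorem comb_eq_zero_of_nonneg (hf : f = fun u => b₀ u - ∑ i, (b i (u - c i) + b i (u + c i))) {u : ℝ}
    (hu : 0 ≤ u) (hu0 : b₀.rOut ≤ u) (hc : ∀ i, (b i).rOut ≤ c i) (hfar : ∀ i, (b i).rOut ≤ |u - c i|) :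
    f u = 0 := by
  refine comb_eq_zero hf (by rwa [abs_of_nonneg hu]) fun i => ⟨hfar i, ?_⟩
  rw [abs_of_nonneg (by linarith [hc i, (b i).rOut_pos])]
  linarith [hc i]

/-- The comb is supported in `[-R, R]` as soon as `R` bounds every support. -/
theorem comb_eq_zero_of_le_abs (hf : f = fun u => b₀ u - ∑ i, (b i (u - c i) + b i (u + c i))) {R u : ℝ}
    (hR0 : b₀.rOut ≤ R) (hR : ∀ i, |c i| + (b i).rOut ≤ R) (hu : R ≤ |u|) : f u = 0 := by
  refine comb_eq_zero hf (hR0.trans hu) fun i => ⟨?_, ?_⟩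
  · have h1 : |u| - |c i| ≤ |u - c i| := abs_sub_abs_le_abs_sub u (c i)
    linarith [hR i]
  · have h1 : |u| - |c i| ≤ |u + c i| := by
      have := abs_sub_abs_le_abs_sub u (-c i)
      rwa [abs_neg, sub_neg_eq_add] at this
    linarith [hR i]

/-- `tsupport f ⊆ [-R, R]` under the same hypothesis. -/
theorem comb_tsupport_subset (hf : f = fun u => b₀ u - ∑ i, (b i (u - c i) + b i (u + c i))) {R : ℝ}
    (hR0 : b₀.rOut ≤ R) (hR : ∀ i, |c i| + (b i).rOut ≤ R) : tsupport f ⊆ Icc (-R) R := by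
  refine closure_minimal (fun u hu => ?_) isClosed_Icc
  rw [Function.mem_support] at hu
  by_contra h
  refine hu (comb_eq_zero_of_le_abs hf hR0 hR ?_)
  rw [mem_Icc, not_and_or, not_le, not_le] at h
  rcases h with h | h
  · exact le_trans (by linarith) (neg_le_abs u)
  · exact le_trans h.le (le_abs_self u)

/-- The comb has compact support. -/
theorem comb_hasCompactSupport (hf : f = fun u => b₀ u - ∑ i, (b i (u - c i) + b i (u + c i))) :
    HasCompactSupport f := by
  set R : ℝ := b₀.rOut + ∑ i, (|c i| + (b i).rOut) with hR
  have hsum : ∀ i, |c i| + (b i).rOut ≤ ∑ j, (|c j| + (b j).rOut) := fun i =>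
    Finset.single_le_sum (f := fun j => |c j| + (b j).rOut)
      (fun j _ => add_nonneg (abs_nonneg _) (b j).rOut_pos.le) (Finset.mem_univ i)
  refine HasCompactSupport.of_support_subset_isCompact (isCompact_Icc (a := -R) (b := R)) ?_
  refine (subset_tsupport f).trans (comb_tsupport_subset hf ?_ fun i => ?_)
  · rw [hR]
    linarith [Finset.sum_nonneg fun j (_ : j ∈ Finset.univ) => add_nonneg (abs_nonneg (c j)) (b j).rOut_pos.le]
  · rw [hR]
    linarith [hsum i, b₀.rOut_pos]

/-- Near the centre only the central bump is seen: `f u = b₀ u` for `|u| ≤ r` when every pair support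
starts beyond `r`. -/
theorem comb_eq_bump (hf : f = fun u => b₀ u - ∑ i, (b i (u - c i) + b i (u + c i))) {r u : ℝ}
    (hu : |u| ≤ r) (hfar : ∀ i, r + (b i).rOut ≤ c i) : f u = b₀ u := by
  rw [hf]
  simp only
  rw [Finset.sum_eq_zero fun i _ => ?_, sub_zero]
  have hci : 0 ≤ c i := by linarith [hfar i, (b i).rOut_pos, abs_nonneg u]
  have h1 : (b i).rOut ≤ |u - c i| := by
    rw [abs_sub_comm]
    have := abs_sub_abs_le_abs_sub (c i) u
    rw [abs_of_nonneg hci] at this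
    linarith [hfar i]
  have h2 : (b i).rOut ≤ |u + c i| := by
    have := abs_sub_abs_le_abs_sub (c i) (-u)
    rw [abs_of_nonneg hci, abs_neg, sub_neg_eq_add, add_comm] at this
    linarith [hfar i]
  rw [bump_eq_zero_of_le_abs (b i) h1, bump_eq_zero_of_le_abs (b i) h2, add_zero]

/-- On the central plateau `f = 1`. -/
theorem comb_eq_one (hf : f = fun u => b₀ u - ∑ i, (b i (u - c i) + b i (u + c i))) {u : ℝ}
    (hu : |u| ≤ b₀.rIn) (hfar : ∀ i, b₀.rIn + (b i).rOut ≤ c i) : f u = 1 := by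
  rw [comb_eq_bump hf hu hfar, bump_eq_one_of_abs_le b₀ hu]

/-- Near the centre `0 ≤ f ≤ 1`. -/
theorem comb_mem_Icc_of_abs_le (hf : f = fun u => b₀ u - ∑ i, (b i (u - c i) + b i (u + c i))) {r u : ℝ}
    (hu : |u| ≤ r) (hfar : ∀ i, r + (b i).rOut ≤ c i) : 0 ≤ f u ∧ f u ≤ 1 := by
  rw [comb_eq_bump hf hu hfar]
  exact ⟨b₀.nonneg, b₀.le_one⟩

/-- Away from the centre, with pairwise disjoint pair supports, at most ONE translated bump is nonzero, so
`-1 ≤ f u ≤ 0`; version for `u ≥ 0`. -/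
theorem comb_mem_Icc_of_le (hf : f = fun u => b₀ u - ∑ i, (b i (u - c i) + b i (u + c i))) {u : ℝ}
    (hu : 0 ≤ u) (hu0 : b₀.rOut ≤ u) (hc : ∀ i, (b i).rOut ≤ c i)
    (hsep : ∀ i j, i ≠ j → (b i).rOut + (b j).rOut ≤ |c i - c j|) : -1 ≤ f u ∧ f u ≤ 0 := by
  classical
  have hplus : ∀ i, b i (u + c i) = 0 := fun i =>
    bump_eq_zero_of_le_abs (b i) (by rw [abs_of_nonneg (by linarith [hc i, (b i).rOut_pos])]; linarith [hc i])
  have hfu : f u = -∑ i, b i (u - c i) := by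
    rw [hf]
    simp only
    rw [bump_eq_zero_of_le_abs b₀ (by rwa [abs_of_nonneg hu]), zero_sub]
    congr 1
    exact Finset.sum_congr rfl fun i _ => by rw [hplus i, add_zero]
  have hS : 0 ≤ ∑ i, b i (u - c i) ∧ ∑ i, b i (u - c i) ≤ 1 := by
    refine ⟨Finset.sum_nonneg fun i _ => (b i).nonneg, ?_⟩
    by_cases h : ∃ j, b j (u - c j) ≠ 0
    · obtain ⟨j, hj⟩ := h
      have hj' := abs_lt_of_bump_ne_zero (b j) hj
      rw [Finset.sum_eq_single j (fun i _ hij => ?_) (fun h => (h (Finset.mem_univ j)).elim)]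
      · exact (b j).le_one
      · by_contra hi
        have hi' := abs_lt_of_bump_ne_zero (b i) hi
        have htri : |c i - c j| ≤ |u - c i| + |u - c j| := by
          have := abs_sub_le (c i) u (c j)
          rwa [abs_sub_comm (c i) u] at this
        linarith [hsep i j hij]
    · push Not at h
      rw [Finset.sum_eq_zero fun i _ => h i]
      exact zero_le_one
  rw [hfu]
  constructor <;> linarith [hS.1, hS.2]

/-- On a pair plateau `f = -1` (version for `u ≥ 0`): `|u - c j| ≤ rIn_j`, and the other pairs are separated
from the `j`-th plateau. -/
theorem comb_eq_neg_one (hf : f = fun u => b₀ u - ∑ i, (b i (u - c i) + b i (u + c i))) {u : ℝ}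
    (hu : 0 ≤ u) (hu0 : b₀.rOut ≤ u) (hc : ∀ i, (b i).rOut ≤ c i) (j : Fin k) (hj : |u - c j| ≤ (b j).rIn)
    (hsep : ∀ i, i ≠ j → (b i).rOut + (b j).rIn ≤ |c i - c j|) : f u = -1 := by
  classical
  rw [hf]
  simp only
  rw [bump_eq_zero_of_le_abs b₀ (by rwa [abs_of_nonneg hu]), zero_sub, neg_inj]
  have hplus : ∀ i, b i (u + c i) = 0 := fun i =>
    bump_eq_zero_of_le_abs (b i) (by rw [abs_of_nonneg (by linarith [hc i, (b i).rOut_pos])]; linarith [hc i])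
  rw [Finset.sum_eq_single j (fun i _ hij => ?_) (fun h => (h (Finset.mem_univ j)).elim), hplus j, add_zero,
    bump_eq_one_of_abs_le (b j) hj]
  rw [hplus i, add_zero]
  refine bump_eq_zero_of_le_abs (b i) ?_
  have htri : |c i - c j| ≤ |u - c i| + |u - c j| := by
    have := abs_sub_le (c i) u (c j)
    rwa [abs_sub_comm (c i) u] at this
  linarith [hsep i hij]

/-- **Origin domination** `|f u| ≤ 1` everywhere (central support before the pairs, pairwise disjoint pairs). -/
theorem comb_abs_le_one (hf : f = fun u => b₀ u - ∑ i, (b i (u - c i) + b i (u + c i)))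
    (hfar : ∀ i, b₀.rOut + (b i).rOut ≤ c i)
    (hsep : ∀ i j, i ≠ j → (b i).rOut + (b j).rOut ≤ |c i - c j|) (u : ℝ) : |f u| ≤ 1 := by
  have hc : ∀ i, (b i).rOut ≤ c i := fun i => by linarith [hfar i, b₀.rOut_pos]
  -- reduce to `u ≥ 0` by evenness
  wlog hu : 0 ≤ u generalizing u
  · have := this (-u) (by linarith)
    rwa [comb_neg hf] at this
  rcases lt_or_ge u b₀.rOut with h | h
  · obtain ⟨h0, h1⟩ := comb_mem_Icc_of_abs_le hf (by rw [abs_of_nonneg hu]; exact h.le) hfar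
    rw [abs_le]; constructor <;> linarith
  · obtain ⟨h0, h1⟩ := comb_mem_Icc_of_le hf hu h hc hsep
    rw [abs_le]; constructor <;> linarith

/-- `f 0 = 1` when the pairs start beyond the central inner radius. -/
theorem comb_zero (hf : f = fun u => b₀ u - ∑ i, (b i (u - c i) + b i (u + c i)))
    (hfar : ∀ i, b₀.rIn + (b i).rOut ≤ c i) : f 0 = 1 :=
  comb_eq_one hf (by rw [abs_zero]; exact b₀.rIn_pos.le) hfar

end Comb

/-- Anchor of this file on the crux item (registered sub-goal): origin domination of the plateau comb
(`comb_abs_le_one`, `∀`-form). -/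
theorem originDominating_comb_abs_le_one : ∀ {k : ℕ} {b₀ : ContDiffBump (0 : ℝ)} {b : Fin k → ContDiffBump (0 : ℝ)} {c : Fin k → ℝ} {f : ℝ → ℝ}, (f = fun u => b₀ u - ∑ i, (b i (u - c i) + b i (u + c i))) → (∀ i, b₀.rOut + (b i).rOut ≤ c i) → (∀ i j, i ≠ j → (b i).rOut + (b j).rOut ≤ |c i - c j|) → ∀ u : ℝ, |f u| ≤ 1 :=
  fun hf hfar hsep u => comb_abs_le_one hf hfar hsep u

end Summit.RiemannHypothesis.RiemannHypothesis.Theorems.SignConeOscillatory.Negative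

end
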